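import Literature.AlgebraicGeometry.AbelianSchemes.AbelianSchemeConstSubgroupQuotientGroupLaw
import Literature.AlgebraicGeometry.AbelianSchemes.AbelianSchemeConstSubgroupQuotientSmooth
import Literature.AlgebraicGeometry.AbelianSchemes.AbelianSchemeOverHomOfReduced
import Literature.AlgebraicGeometry.AbelianSchemes.PolarizationLamTranslationInvariance
import HarnessLib

/-!
# The quotient block fields `(hG, hsm, hgc)` of `A/K` and of the dual side `Â/K′` over a reduced base

Layer `Literature/AlgebraicGeometry/AbelianSchemes`, namespace `Literature.AlgebraicGeometry.AbelianSchemes.AbelianSchemeOver`.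
THEOREMS ONLY (no definition, no named fact, no instance, no notation, no `sorry`); over ★
`AbelianSchemeConstSubgroupQuotientGroupLaw` (`exists_grpObj_isMonHom_quotientMk`, `geometricallyConnected_quotientOver_hom`),
★ `AbelianSchemeConstSubgroupQuotientSmooth` (`smooth_quotientOver_hom_of_hom_spec`), ★ `AbelianSchemeOverHomOfReduced`
(`isCommMonObj_of_isReduced_base`, [MumfordFogartyKirwan1994] Cor. 6.5) and ★ `PolarizationLamTranslationInvariance`
(`finite_map_isMonHom_monoidHom`).

Setting ([MumfordAV1970] §7 Thm. 4 p. 72, §23 p. 231): an abelian scheme `A → S` over a REDUCED locally Noetherian base `S`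
lying over an affine `Y` (`u : S → Y`; in the Siegel situation `Y = Spec ℂ` and `u` is the structure morphism of the open
piece), its dual pair `D = (Â, 𝒫)`, and finite subgroups of sections `K ≤ A(S)`, `K′ ≤ Â(S)` covered by stable affine opens
(`hcov`, `hcov′`) and acting freely on geometric points (`hfree`, `hfree′`).  The tree's quotient abelian scheme
★ `quotientBy u K hcov hG hsm hgc` reads three RAW fields — a group law on `A/K` making `ψ` a homomorphism (`hG`), smoothness
(`hsm`) and geometric connectedness (`hgc`) of `A/K → S` — each discharged by a ★ theorem.  This file PACKAGES them:

* §1 `quotientBlock_of_free` — the three fields of `A/K` at once (commutativity of `A` from the reduced base);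
  `quotientBlock_of_free_spec` — the shape `Y = Spec k`, `u = S → Spec k` both the affine target and the characteristic-`0`
  witness (the open piece of the Siegel modular variety over `ℂ`).
* §2 `hat_exists_grpObj_isMonHom_quotientMk`, `hat_smooth_quotientOver_hom_of_hom_spec`,
  `hat_geometricallyConnected_quotientOver_hom` — the three fields of the DUAL SIDE `Â/K′` by name (`Â` is commutative over
  the reduced base, ★ Cor. 6.5 — the one instance the generic ★ theorems do not find by themselves), and the bundles
  `hat_quotientBlock_of_free` / `hat_quotientBlock_of_free_spec`.
* §3 `hat_quotientBlock_map_of_free` / `…_spec` — the same for the IMAGE subgroup `K′ := f_* K = K.map (σ ↦ σ ≫ f)` of a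
  finite `K ≤ A(S)` under a homomorphism `f : A → Â` (the spelling of record `K.map (IsMonHom.monoidHom λ′ (𝟙_ (Over S)))`
  of the Hecke-link package, `f := λ′` the polarisation; finiteness ★ `finite_map_isMonHom_monoidHom`), the freeness of
  `K′` being an INPUT (`hfree′`, its producer is ★ `PolarizationLamImageFree`).

Cell `hodgecm-mathlib` (D-0151), HECKE-LINK socket (B): the `hG′/hsm′/hgc′` (and `hG/hsm/hgc`) conjuncts of the `hExt`
package of ★ `SiegelHeckeQuotientTripleGlue.exists_heckeQuotientTriple_of_ext`, consumed BY NAME by the package assembler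
`Summits/…/Theorems/EquidimHeckeQuotientTriplesOfPiece`.  Count-neutral; HC_CM is proved only modulo the 7 printed
citations until rung 0 closes; nothing here is about HC.

## References
* [MumfordAV1970] D. Mumford, *Abelian Varieties* (1970), §7 Thm. 4 (p. 72), §23 (p. 231).
* [MumfordFogartyKirwan1994] D. Mumford, J. Fogarty, F. Kirwan, *Geometric Invariant Theory*, 3rd ed. (1994), Ch. 6 §1
  Corollary 6.5 (p. 117).
* [Grothendieck1967] A. Grothendieck, *EGA IV₄*, Prop. 17.7.7.
-/

noncomputable section

universe u

open CategoryTheory CategoryTheory.Limits AlgebraicGeometry MonoidalCategory CartesianMonoidalCategory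
open scoped MonObj

namespace Literature.AlgebraicGeometry.AbelianSchemes

namespace AbelianSchemeOver

variable {S : Scheme.{u}} (A : AbelianSchemeOver S)

/-! ## §1 The block fields of `A/K` -/

/-- **The three block fields `(hG, hsm, hgc)` of the quotient `A/K` at once** — group law with `ψ` a homomorphism,
smoothness and geometric connectedness of `A/K → S` — for a finite subgroup of sections `K` covered by stable affine opens
and acting freely on geometric points, over a reduced locally Noetherian base of characteristic `0` (`hS : S → Spec k`)
lying over an affine `Y` (★ `exists_grpObj_isMonHom_quotientMk`, ★ `smooth_quotientOver_hom_of_hom_spec`,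
★ `geometricallyConnected_quotientOver_hom`; `A` is commutative by ★ `isCommMonObj_of_isReduced_base`).
[cite: MumfordAV1970, §7 Thm. 4 (p. 72)] [cite: MumfordFogartyKirwan1994, Ch. 6 §1 Corollary 6.5 (p. 117)] -/
theorem quotientBlock_of_free [IsReduced S] [IsLocallyNoetherian S] {Y : Scheme.{u}} (u : S ⟶ Y)
    (K : Subgroup A.Sections) [Finite K] [Y.IsSeparated] [IsSeparated (A.X.hom ≫ u)] [S.IsSeparated] [IsAffine Y]
    [LocallyOfFiniteType (A.X.hom ≫ u)] [IsLocallyNoetherian Y]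
    (hcov : ∀ x : A.left, ∃ O : (A.translationActionOver u K).StableAffineOpens, x ∈ O.1)
    {k : Type u} [Field k] [CharZero k] (hS : S ⟶ Spec (.of k))
    (hfree : ∀ (Ω : Type u) [Field Ω] [IsAlgClosed Ω] (x : Spec (.of Ω) ⟶ A.left) (σ : K), σ ≠ 1 →
      x ≫ (A.translation (σ : A.Sections)).left ≠ x) :
    (∃ _ : GrpObj (A.quotientOver u K), IsMonHom (A.quotientMk u K hcov)) ∧
      Smooth (A.quotientOver u K).hom ∧ GeometricallyConnected (A.quotientOver u K).hom := by
  haveI : IsCommMonObj A.X := A.isCommMonObj_of_isReduced_base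
  exact ⟨A.exists_grpObj_isMonHom_quotientMk u K hcov hfree, A.smooth_quotientOver_hom_of_hom_spec u K hcov hS hfree,
    A.geometricallyConnected_quotientOver_hom u K hcov⟩

/-- **The block fields of `A/K` in the shape `Y = Spec k`** (`u : S → Spec k` is both the affine target of the stable
affine cover and the characteristic-`0` witness; the open piece of the Siegel modular variety over `ℂ`).
[cite: MumfordAV1970, §7 Thm. 4 (p. 72)] [cite: MumfordFogartyKirwan1994, Ch. 6 §1 Corollary 6.5 (p. 117)] -/
theorem quotientBlock_of_free_spec [IsReduced S] [IsLocallyNoetherian S] {k : Type u} [Field k] [CharZero k]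
    (u : S ⟶ Spec (.of k)) (K : Subgroup A.Sections) [Finite K] [IsSeparated (A.X.hom ≫ u)] [S.IsSeparated]
    [LocallyOfFiniteType (A.X.hom ≫ u)]
    (hcov : ∀ x : A.left, ∃ O : (A.translationActionOver u K).StableAffineOpens, x ∈ O.1)
    (hfree : ∀ (Ω : Type u) [Field Ω] [IsAlgClosed Ω] (x : Spec (.of Ω) ⟶ A.left) (σ : K), σ ≠ 1 →
      x ≫ (A.translation (σ : A.Sections)).left ≠ x) :
    (∃ _ : GrpObj (A.quotientOver u K), IsMonHom (A.quotientMk u K hcov)) ∧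
      Smooth (A.quotientOver u K).hom ∧ GeometricallyConnected (A.quotientOver u K).hom :=
  A.quotientBlock_of_free u K hcov u hfree

/-! ## §2 The block fields of the dual side `Â/K′` -/

section Hat

variable {Y : Scheme.{u}} (u : S ⟶ Y) (D : A.DualPair) (K' : Subgroup D.hat.Sections) [Finite K'] [Y.IsSeparated]
  [IsSeparated (D.hat.X.hom ≫ u)] [S.IsSeparated]
  (hcov' : ∀ x : D.hat.left, ∃ O : (D.hat.translationActionOver u K').StableAffineOpens, x ∈ O.1)

/-- **`hG′`: the group law of `Â` descends to `Â/K′` and `ψ′ : Â → Â/K′` is a homomorphism** — ★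
`exists_grpObj_isMonHom_quotientMk` for the dual abelian scheme, commutative over the reduced base (★ Cor. 6.5).
[cite: MumfordAV1970, §7 Thm. 4 (p. 72)] [cite: MumfordFogartyKirwan1994, Ch. 6 §1 Corollary 6.5 (p. 117)] -/
theorem hat_exists_grpObj_isMonHom_quotientMk [IsReduced S] [IsLocallyNoetherian S] [IsAffine Y]
    (hfree' : ∀ (Ω : Type u) [Field Ω] [IsAlgClosed Ω] (x : Spec (.of Ω) ⟶ D.hat.left) (σ : K'), σ ≠ 1 →
      x ≫ (D.hat.translation (σ : D.hat.Sections)).left ≠ x) :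
    ∃ _ : GrpObj (D.hat.quotientOver u K'), IsMonHom (D.hat.quotientMk u K' hcov') := by
  haveI : IsCommMonObj D.hat.X := D.hat.isCommMonObj_of_isReduced_base
  exact D.hat.exists_grpObj_isMonHom_quotientMk u K' hcov' hfree'

include hcov' in
/-- **`hsm′`: `Â/K′ → S` is smooth** (base of characteristic `0`, `hS : S → Spec k`) — ★
`smooth_quotientOver_hom_of_hom_spec` for the dual abelian scheme. [cite: MumfordAV1970, §7 Thm. 4 (p. 72)]
[cite: Grothendieck1967, Prop. 17.7.7] -/
theorem hat_smooth_quotientOver_hom_of_hom_spec [IsLocallyNoetherian S] [IsAffine Y]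
    [LocallyOfFiniteType (D.hat.X.hom ≫ u)] [IsLocallyNoetherian Y] {k : Type u} [Field k] [CharZero k]
    (hS : S ⟶ Spec (.of k))
    (hfree' : ∀ (Ω : Type u) [Field Ω] [IsAlgClosed Ω] (x : Spec (.of Ω) ⟶ D.hat.left) (σ : K'), σ ≠ 1 →
      x ≫ (D.hat.translation (σ : D.hat.Sections)).left ≠ x) :
    Smooth (D.hat.quotientOver u K').hom :=
  D.hat.smooth_quotientOver_hom_of_hom_spec u K' hcov' hS hfree'

include hcov' in
/-- **`hgc′`: the fibres of `Â/K′ → S` are geometrically connected** — ★ `geometricallyConnected_quotientOver_hom` for the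
dual abelian scheme. [cite: MumfordAV1970, §7 Thm. 4 (p. 72)] -/
theorem hat_geometricallyConnected_quotientOver_hom : GeometricallyConnected (D.hat.quotientOver u K').hom :=
  D.hat.geometricallyConnected_quotientOver_hom u K' hcov'

/-- **The three block fields `(hG′, hsm′, hgc′)` of the dual side `Â/K′` at once.**
[cite: MumfordAV1970, §7 Thm. 4 (p. 72)] [cite: MumfordFogartyKirwan1994, Ch. 6 §1 Corollary 6.5 (p. 117)] -/
theorem hat_quotientBlock_of_free [IsReduced S] [IsLocallyNoetherian S] [IsAffine Y]
    [LocallyOfFiniteType (D.hat.X.hom ≫ u)] [IsLocallyNoetherian Y] {k : Type u} [Field k] [CharZero k]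
    (hS : S ⟶ Spec (.of k))
    (hfree' : ∀ (Ω : Type u) [Field Ω] [IsAlgClosed Ω] (x : Spec (.of Ω) ⟶ D.hat.left) (σ : K'), σ ≠ 1 →
      x ≫ (D.hat.translation (σ : D.hat.Sections)).left ≠ x) :
    (∃ _ : GrpObj (D.hat.quotientOver u K'), IsMonHom (D.hat.quotientMk u K' hcov')) ∧
      Smooth (D.hat.quotientOver u K').hom ∧ GeometricallyConnected (D.hat.quotientOver u K').hom :=
  ⟨A.hat_exists_grpObj_isMonHom_quotientMk u D K' hcov' hfree',
    A.hat_smooth_quotientOver_hom_of_hom_spec u D K' hcov' hS hfree',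
    A.hat_geometricallyConnected_quotientOver_hom u D K' hcov'⟩

end Hat

/-- **The block fields of `Â/K′` in the shape `Y = Spec k`** (`u : S → Spec k`).
[cite: MumfordAV1970, §7 Thm. 4 (p. 72)] [cite: MumfordFogartyKirwan1994, Ch. 6 §1 Corollary 6.5 (p. 117)] -/
theorem hat_quotientBlock_of_free_spec [IsReduced S] [IsLocallyNoetherian S] {k : Type u} [Field k] [CharZero k]
    (u : S ⟶ Spec (.of k)) (D : A.DualPair) (K' : Subgroup D.hat.Sections) [Finite K'] [IsSeparated (D.hat.X.hom ≫ u)]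
    [S.IsSeparated] [LocallyOfFiniteType (D.hat.X.hom ≫ u)]
    (hcov' : ∀ x : D.hat.left, ∃ O : (D.hat.translationActionOver u K').StableAffineOpens, x ∈ O.1)
    (hfree' : ∀ (Ω : Type u) [Field Ω] [IsAlgClosed Ω] (x : Spec (.of Ω) ⟶ D.hat.left) (σ : K'), σ ≠ 1 →
      x ≫ (D.hat.translation (σ : D.hat.Sections)).left ≠ x) :
    (∃ _ : GrpObj (D.hat.quotientOver u K'), IsMonHom (D.hat.quotientMk u K' hcov')) ∧
      Smooth (D.hat.quotientOver u K').hom ∧ GeometricallyConnected (D.hat.quotientOver u K').hom :=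
  A.hat_quotientBlock_of_free u D K' hcov' u hfree'

/-! ## §3 The dual side at the image subgroup `K′ := f_* K` -/

/-- **The three block fields `(hG′, hsm′, hgc′)` of `Â/K′` for the IMAGE subgroup `K′ := f_* K = K.map (σ ↦ σ ≫ f)`** of a
finite `K ≤ A(S)` under a homomorphism `f : A → Â` (the Hecke-link spelling `K.map (IsMonHom.monoidHom λ′ (𝟙_ (Over S)))`,
`f := λ′`; `K′` is finite by ★ `finite_map_isMonHom_monoidHom`), given its stable affine cover `hcov′` and its freeness
`hfree′` (producer: ★ `PolarizationLamImageFree`). [cite: MumfordAV1970, §7 Thm. 4 (p. 72) and §23 (p. 231)]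
[cite: MumfordFogartyKirwan1994, Ch. 6 §1 Corollary 6.5 (p. 117)] -/
theorem hat_quotientBlock_map_of_free [IsReduced S] [IsLocallyNoetherian S] {Y : Scheme.{u}} (u : S ⟶ Y)
    (D : A.DualPair) (f : A.X ⟶ D.hat.X) [IsMonHom f] (K : Subgroup A.Sections) [Finite K] [Y.IsSeparated]
    [IsSeparated (D.hat.X.hom ≫ u)] [S.IsSeparated] [IsAffine Y] [LocallyOfFiniteType (D.hat.X.hom ≫ u)]
    [IsLocallyNoetherian Y] {k : Type u} [Field k] [CharZero k] (hS : S ⟶ Spec (.of k))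
    (hcov' : haveI := A.finite_map_isMonHom_monoidHom f K
      ∀ x : D.hat.left,
        ∃ O : (D.hat.translationActionOver u (K.map (IsMonHom.monoidHom f (𝟙_ (Over S))))).StableAffineOpens, x ∈ O.1)
    (hfree' : ∀ (Ω : Type u) [Field Ω] [IsAlgClosed Ω] (x : Spec (.of Ω) ⟶ D.hat.left)
      (σ : K.map (IsMonHom.monoidHom f (𝟙_ (Over S)))), σ ≠ 1 →
      x ≫ (D.hat.translation (σ : D.hat.Sections)).left ≠ x) :
    haveI := A.finite_map_isMonHom_monoidHom f K
    (∃ _ : GrpObj (D.hat.quotientOver u (K.map (IsMonHom.monoidHom f (𝟙_ (Over S))))),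
        IsMonHom (D.hat.quotientMk u (K.map (IsMonHom.monoidHom f (𝟙_ (Over S)))) hcov')) ∧
      Smooth (D.hat.quotientOver u (K.map (IsMonHom.monoidHom f (𝟙_ (Over S))))).hom ∧
      GeometricallyConnected (D.hat.quotientOver u (K.map (IsMonHom.monoidHom f (𝟙_ (Over S))))).hom := by
  haveI := A.finite_map_isMonHom_monoidHom f K
  exact A.hat_quotientBlock_of_free u D _ hcov' hS hfree'

/-- **The block fields of `Â/(f_* K)` in the shape `Y = Spec k`** (`u : S → Spec k`; the open piece of the Siegel modular
variety over `ℂ`, `f := λ′` the universal polarisation). [cite: MumfordAV1970, §7 Thm. 4 (p. 72) and §23 (p. 231)]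
[cite: MumfordFogartyKirwan1994, Ch. 6 §1 Corollary 6.5 (p. 117)] -/
theorem hat_quotientBlock_map_of_free_spec [IsReduced S] [IsLocallyNoetherian S] {k : Type u} [Field k] [CharZero k]
    (u : S ⟶ Spec (.of k)) (D : A.DualPair) (f : A.X ⟶ D.hat.X) [IsMonHom f] (K : Subgroup A.Sections) [Finite K]
    [IsSeparated (D.hat.X.hom ≫ u)] [S.IsSeparated] [LocallyOfFiniteType (D.hat.X.hom ≫ u)]
    (hcov' : haveI := A.finite_map_isMonHom_monoidHom f K
      ∀ x : D.hat.left,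
        ∃ O : (D.hat.translationActionOver u (K.map (IsMonHom.monoidHom f (𝟙_ (Over S))))).StableAffineOpens, x ∈ O.1)
    (hfree' : ∀ (Ω : Type u) [Field Ω] [IsAlgClosed Ω] (x : Spec (.of Ω) ⟶ D.hat.left)
      (σ : K.map (IsMonHom.monoidHom f (𝟙_ (Over S)))), σ ≠ 1 →
      x ≫ (D.hat.translation (σ : D.hat.Sections)).left ≠ x) :
    haveI := A.finite_map_isMonHom_monoidHom f K
    (∃ _ : GrpObj (D.hat.quotientOver u (K.map (IsMonHom.monoidHom f (𝟙_ (Over S))))),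
        IsMonHom (D.hat.quotientMk u (K.map (IsMonHom.monoidHom f (𝟙_ (Over S)))) hcov')) ∧
      Smooth (D.hat.quotientOver u (K.map (IsMonHom.monoidHom f (𝟙_ (Over S))))).hom ∧
      GeometricallyConnected (D.hat.quotientOver u (K.map (IsMonHom.monoidHom f (𝟙_ (Over S))))).hom :=
  A.hat_quotientBlock_map_of_free u D f K u hcov' hfree'

end AbelianSchemeOver

end Literature.AlgebraicGeometry.AbelianSchemes

end
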